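import Literature.AlgebraicGeometry.Motives.WeilTypePeriodDomainTopology
import Mathlib.Analysis.Convex.Contractible
import HarnessLib

/-!
# `X⁺(H₀) ≃ₜ I_{p,q}`: the angular-operator parametrisation is a homeomorphism (inverse `J ↦ Z`)

Layer `Literature/AlgebraicGeometry/Motives`, namespace `Literature.AlgebraicGeometry.Motives`; lane
`lit-hodgefound` (Track 2 foundations library), Layer A (period domain of abelian varieties of Weil type;
prover seat p13, generation 8, FILE 7 of the self-proposed row «van Geemen 1994 Lemma 5.10»). Sequel of
`Motives/WeilTypePeriodDomainTopology`, which realises the bijection `X⁺(H₀) ≃ unitaryPeriodDomain p q` of the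
standard Hermitian space `(ℂᵖ × ℂ^q, H₀)` by the explicit CONTINUOUS map `Z ↦ J_Z = i(2P_Z - 1)`
(`continuousOn_stdJOp`, `stdJOp_image`) and records in its docstring: "Not here: the inverse `J ↦ Z` is also
continuous (so `Z ↦ J_Z` is a homeomorphism onto `X⁺`)". This file supplies exactly that inverse and the
homeomorphism.

THE INVERSE (Gohberg–Lancaster–Rodman §10.1: a graph subspace `G(K) = Im [I; K]` determines its angular
operator `K`; here read off the projection). For `J ∈ X⁺(H₀)` put `P = ½(1 - iJ)` (the projection onto the
`+i`-eigenspace `W = {J = i}` along `{J = -i}`; for `J = J_Z` this is `P_Z`, `projOfJ_stdJOp`). Writing `P` in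
blocks for `ℂᵖ × ℂ^q`, `P(x₁, 0) = (P₁₁ x₁, P₂₁ x₁)`: for `P = P_Z` one has `P₁₁ = (1 - Z^*Z)⁻¹` (invertible) and
`P₂₁ = Z (1 - Z^*Z)⁻¹` (`cblock₁₁_stdProjOp`, `cblock₂₁_stdProjOp`, from the tree's `stdProjOp_apply`), so the
ANGULAR OPERATOR `Z = P₂₁ ∘ P₁₁⁻¹` (`angularOp`, `angularOp_stdJOp`) recovers `Z` from `J_Z`; it is continuous
on `X⁺(H₀)` because the blocks are continuous linear in `J` and `Ring.inverse` is continuous at units of the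
Banach algebra `End(ℂᵖ)` (`continuousOn_angularOp`).

## What is proved (no definition of a new notion; the three `def`s are explicit operators with bodies)

* `cblock₁₁`, `cblock₂₁` (blocks of a bounded operator on `ℂᵖ × ℂ^q`), `projOfJ J = ½(1 - iJ)`,
  `angularOp J = P₂₁ ∘ P₁₁⁻¹`; `projOfJ_stdJOp : projOfJ (J_Z) = P_Z`; `angularOp_stdJOp : angularOp (J_Z) = Z`
  on the ball; `stdJOp_injOn`; `angularOp_mem_unitaryPeriodDomain`, `stdJOp_angularOp` on `X⁺(H₀)`;
  `continuousOn_angularOp`; `angularOp_eq_stdWeilComplexStructureEquiv` (the angular operator is the tree's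
  bijection `stdWeilComplexStructureEquiv`, which the homeomorphism therefore upgrades);
* **`unitaryPeriodDomainHomeomorph : unitaryPeriodDomain p q ≃ₜ stdWeilDomain p q`** — `Z ↦ J_Z` is a
  HOMEOMORPHISM of the open unit ball `I_{p,q} ⊂ Hom(ℂᵖ, ℂ^q)` onto `X⁺(H₀) ⊂ End(ℂᵖ × ℂ^q)`;
* corollaries: `stdWeilDomainHomeomorphBall : stdWeilDomain p q ≃ₜ Metric.ball 0 1`,
  `contractibleSpace_stdWeilDomain` (a convex ball is contractible).

Source: Gohberg–Lancaster–Rodman, *Indefinite Linear Algebra and Applications* (2005), §10.1 (graph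
subspaces `G(K) = Im [I; K]` and their angular operators, Lemma 10.1.2, (10.1.5)–(10.1.9)); Deligne, LNM 900,
proof of Thm. 4.8, p. 49 ("`X⁺` can be identified with `{V ⊂ H | …}` … an open connected complex submanifold of
a Grassmannian"); Carlson–Müller-Stach–Peters, Thm. 16.1.5 (type AIII: "`SU(p,q)/S(U(p) × U(q))` with
realization as a bounded domain `I_{p,q}`"). No named fact; net debt 0.

## References

* [GohbergLancasterRodman2005] I. Gohberg, P. Lancaster, L. Rodman, *Indefinite Linear Algebra and Applications*
  (2005), §10.1 (angular operator of a graph subspace), §10.2 (10.2.18)–(10.2.19).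
* [Deligne1982HodgeCycles] P. Deligne, LNM 900 (1982), proof of Thm. 4.8, p. 49.
* [CarlsonMullerStachPeters2017] J. Carlson, S. Müller-Stach, C. Peters, *Period Mappings and Period Domains*,
  2nd ed., Thm. 16.1.5 (type AIII).
* [vanGeemen1994HodgeAV] B. van Geemen, LNM 1594 (1994), 5.5–5.10.
-/

noncomputable section

open Module

namespace Literature.AlgebraicGeometry.Motives

variable {p q : ℕ}

/-! ### Blocks, the projection `½(1 - iJ)` and the angular operator -/

/-- The `(1,1)`-block `A₁₁ = pr₁ ∘ A ∘ ι₁ ∈ End(ℂᵖ)` of a bounded operator `A` on `ℂᵖ × ℂ^q`.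
[cite: GohbergLancasterRodman2005, §10.2, proof of Thm. 10.2.4 (block form)] -/
def cblock₁₁ (A : (EuclideanSpace ℂ (Fin p) × EuclideanSpace ℂ (Fin q)) →L[ℂ]
    (EuclideanSpace ℂ (Fin p) × EuclideanSpace ℂ (Fin q))) :
    EuclideanSpace ℂ (Fin p) →L[ℂ] EuclideanSpace ℂ (Fin p) :=
  (ContinuousLinearMap.fst ℂ _ _).comp (A.comp (ContinuousLinearMap.inl ℂ _ _))

/-- The `(2,1)`-block `A₂₁ = pr₂ ∘ A ∘ ι₁ : ℂᵖ → ℂ^q`. [cite: GohbergLancasterRodman2005, §10.2, proof of Thm. 10.2.4] -/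
def cblock₂₁ (A : (EuclideanSpace ℂ (Fin p) × EuclideanSpace ℂ (Fin q)) →L[ℂ]
    (EuclideanSpace ℂ (Fin p) × EuclideanSpace ℂ (Fin q))) :
    EuclideanSpace ℂ (Fin p) →L[ℂ] EuclideanSpace ℂ (Fin q) :=
  (ContinuousLinearMap.snd ℂ _ _).comp (A.comp (ContinuousLinearMap.inl ℂ _ _))

/-- `A₁₁ v = (A (v, 0)).1`. [cite: GohbergLancasterRodman2005, §10.2] -/
@[simp] theorem cblock₁₁_apply (A : (EuclideanSpace ℂ (Fin p) × EuclideanSpace ℂ (Fin q)) →L[ℂ]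
    (EuclideanSpace ℂ (Fin p) × EuclideanSpace ℂ (Fin q))) (v : EuclideanSpace ℂ (Fin p)) :
    cblock₁₁ A v = (A (v, 0)).1 := rfl

/-- `A₂₁ v = (A (v, 0)).2`. [cite: GohbergLancasterRodman2005, §10.2] -/
@[simp] theorem cblock₂₁_apply (A : (EuclideanSpace ℂ (Fin p) × EuclideanSpace ℂ (Fin q)) →L[ℂ]
    (EuclideanSpace ℂ (Fin p) × EuclideanSpace ℂ (Fin q))) (v : EuclideanSpace ℂ (Fin p)) :
    cblock₂₁ A v = (A (v, 0)).2 := rfl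

/-- `A ↦ A₁₁` is continuous. [cite: GohbergLancasterRodman2005, §10.2] -/
theorem continuous_cblock₁₁ :
    Continuous (cblock₁₁ : ((EuclideanSpace ℂ (Fin p) × EuclideanSpace ℂ (Fin q)) →L[ℂ]
      (EuclideanSpace ℂ (Fin p) × EuclideanSpace ℂ (Fin q))) → _) :=
  continuous_const.clm_comp (continuous_id.clm_comp continuous_const)

/-- `A ↦ A₂₁` is continuous. [cite: GohbergLancasterRodman2005, §10.2] -/
theorem continuous_cblock₂₁ :
    Continuous (cblock₂₁ : ((EuclideanSpace ℂ (Fin p) × EuclideanSpace ℂ (Fin q)) →L[ℂ]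
      (EuclideanSpace ℂ (Fin p) × EuclideanSpace ℂ (Fin q))) → _) :=
  continuous_const.clm_comp (continuous_id.clm_comp continuous_const)

/-- `P(J) = ½(1 - iJ)`: for a complex structure `J` the projection onto `{J = i}` along `{J = -i}`.
[cite: Deligne1982HodgeCycles, proof of Thm. 4.8, p. 49 ("`J` is determined by its `+i`-eigenspace")] -/
def projOfJ (J : (EuclideanSpace ℂ (Fin p) × EuclideanSpace ℂ (Fin q)) →L[ℂ]
    (EuclideanSpace ℂ (Fin p) × EuclideanSpace ℂ (Fin q))) :
    (EuclideanSpace ℂ (Fin p) × EuclideanSpace ℂ (Fin q)) →L[ℂ]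
      (EuclideanSpace ℂ (Fin p) × EuclideanSpace ℂ (Fin q)) :=
  (2 : ℂ)⁻¹ • (1 - Complex.I • J)

/-- `J ↦ P(J)` is continuous. [cite: Deligne1982HodgeCycles, proof of Thm. 4.8, p. 49] -/
theorem continuous_projOfJ :
    Continuous (projOfJ : ((EuclideanSpace ℂ (Fin p) × EuclideanSpace ℂ (Fin q)) →L[ℂ]
      (EuclideanSpace ℂ (Fin p) × EuclideanSpace ℂ (Fin q))) → _) :=
  show Continuous fun J : (EuclideanSpace ℂ (Fin p) × EuclideanSpace ℂ (Fin q)) →L[ℂ]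
      (EuclideanSpace ℂ (Fin p) × EuclideanSpace ℂ (Fin q)) => (2 : ℂ)⁻¹ • (1 - Complex.I • J) by
    fun_prop

/-- `½(1 - i · i(2P - 1)) = P`. [folklore] -/
private theorem half_one_sub_I_I {T : Type*} [NormedAddCommGroup T] [NormedSpace ℂ T] (P : T →L[ℂ] T) :
    (2 : ℂ)⁻¹ • (1 - Complex.I • (Complex.I • ((2 : ℂ) • P - 1))) = P := by
  rw [smul_smul, Complex.I_mul_I, neg_smul, one_smul, sub_neg_eq_add, add_sub_cancel, smul_smul,
    inv_mul_cancel₀ (two_ne_zero : (2 : ℂ) ≠ 0), one_smul]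

/-- **`P(J_Z) = P_Z`**: `½(1 - i · i(2P_Z - 1)) = P_Z`. [cite: vanGeemen1994HodgeAV, 5.5] [cite: GohbergLancasterRodman2005, §10.1] -/
theorem projOfJ_stdJOp (Z : EuclideanSpace ℂ (Fin p) →L[ℂ] EuclideanSpace ℂ (Fin q)) :
    projOfJ (stdJOp Z) = stdProjOp Z :=
  half_one_sub_I_I (stdProjOp Z)

/-- **The angular operator `Z(J) = P₂₁ ∘ P₁₁⁻¹`** of the `+i`-eigenspace of `J` (`Ring.inverse`, so defined for
every `J`). [cite: GohbergLancasterRodman2005, §10.1 (angular operator of a graph subspace) and §10.2 ("`X = (A₁₁ + A₁₂K)⁻¹`")] -/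
def angularOp (J : (EuclideanSpace ℂ (Fin p) × EuclideanSpace ℂ (Fin q)) →L[ℂ]
    (EuclideanSpace ℂ (Fin p) × EuclideanSpace ℂ (Fin q))) :
    EuclideanSpace ℂ (Fin p) →L[ℂ] EuclideanSpace ℂ (Fin q) :=
  (cblock₂₁ (projOfJ J)).comp (Ring.inverse (cblock₁₁ (projOfJ J)))

/-- `(P_Z)₁₁ = (1 - Z^*Z)⁻¹`. [cite: GohbergLancasterRodman2005, §10.1 (10.1.5)–(10.1.9)] -/
theorem cblock₁₁_stdProjOp (Z : EuclideanSpace ℂ (Fin p) →L[ℂ] EuclideanSpace ℂ (Fin q)) :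
    cblock₁₁ (stdProjOp Z) = Ring.inverse (stdGramOp Z) := by
  ext v
  rw [cblock₁₁_apply, stdProjOp_apply]
  simp

/-- `(P_Z)₂₁ = Z (1 - Z^*Z)⁻¹`. [cite: GohbergLancasterRodman2005, §10.1 (10.1.5)–(10.1.9)] -/
theorem cblock₂₁_stdProjOp (Z : EuclideanSpace ℂ (Fin p) →L[ℂ] EuclideanSpace ℂ (Fin q)) :
    cblock₂₁ (stdProjOp Z) = Z.comp (Ring.inverse (stdGramOp Z)) := by
  ext v
  rw [cblock₂₁_apply, stdProjOp_apply]
  simp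

/-- **`Z(J_Z) = Z` on the ball**: the angular operator recovers `Z` from `J_Z`.
[cite: GohbergLancasterRodman2005, §10.1 Lemma 10.1.2 (a graph subspace determines its angular operator)] -/
theorem angularOp_stdJOp {Z : EuclideanSpace ℂ (Fin p) →L[ℂ] EuclideanSpace ℂ (Fin q)}
    (hZ : Z ∈ unitaryPeriodDomain p q) : angularOp (stdJOp Z) = Z := by
  obtain ⟨u, hu⟩ := isUnit_stdGramOp hZ
  rw [angularOp, projOfJ_stdJOp, cblock₁₁_stdProjOp, cblock₂₁_stdProjOp, ← hu, Ring.inverse_unit,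
    Ring.inverse_unit, inv_inv, ContinuousLinearMap.comp_assoc, ← ContinuousLinearMap.mul_def, Units.inv_mul,
    ContinuousLinearMap.one_def, ContinuousLinearMap.comp_id]

/-- `Z ↦ J_Z` is injective on the ball. [cite: GohbergLancasterRodman2005, §10.1 Lemma 10.1.2] -/
theorem stdJOp_injOn :
    Set.InjOn (stdJOp : (EuclideanSpace ℂ (Fin p) →L[ℂ] EuclideanSpace ℂ (Fin q)) → _) (unitaryPeriodDomain p q) :=
  fun Z hZ Z' hZ' h => by rw [← angularOp_stdJOp hZ, ← angularOp_stdJOp hZ', h]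

/-- For `J ∈ X⁺(H₀)`, **`Z(J)` lies in the ball**. [cite: vanGeemen1994HodgeAV, 5.8] [cite: GohbergLancasterRodman2005, §10.1] -/
theorem angularOp_mem_unitaryPeriodDomain
    {J : (EuclideanSpace ℂ (Fin p) × EuclideanSpace ℂ (Fin q)) →L[ℂ]
      (EuclideanSpace ℂ (Fin p) × EuclideanSpace ℂ (Fin q))} (hJ : J ∈ stdWeilDomain p q) :
    angularOp J ∈ unitaryPeriodDomain p q := by
  rw [← stdJOp_image] at hJ
  obtain ⟨Z, hZ, rfl⟩ := hJ
  rwa [angularOp_stdJOp hZ]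

/-- For `J ∈ X⁺(H₀)`, **`J_{Z(J)} = J`**. [cite: vanGeemen1994HodgeAV, 5.5–5.8] [cite: GohbergLancasterRodman2005, §10.1] -/
theorem stdJOp_angularOp
    {J : (EuclideanSpace ℂ (Fin p) × EuclideanSpace ℂ (Fin q)) →L[ℂ]
      (EuclideanSpace ℂ (Fin p) × EuclideanSpace ℂ (Fin q))} (hJ : J ∈ stdWeilDomain p q) :
    stdJOp (angularOp J) = J := by
  rw [← stdJOp_image] at hJ
  obtain ⟨Z, hZ, rfl⟩ := hJ
  rw [angularOp_stdJOp hZ]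

/-- For `J ∈ X⁺(H₀)` the block `P₁₁` is invertible (`= (1 - Z^*Z)⁻¹`). [cite: GohbergLancasterRodman2005, §10.1 and §10.2 ("`A₁₁ + A₁₂K` is invertible")] -/
theorem isUnit_cblock₁₁_projOfJ
    {J : (EuclideanSpace ℂ (Fin p) × EuclideanSpace ℂ (Fin q)) →L[ℂ]
      (EuclideanSpace ℂ (Fin p) × EuclideanSpace ℂ (Fin q))} (hJ : J ∈ stdWeilDomain p q) :
    IsUnit (cblock₁₁ (projOfJ J)) := by
  rw [← stdJOp_image] at hJ
  obtain ⟨Z, hZ, rfl⟩ := hJ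
  obtain ⟨u, hu⟩ := isUnit_stdGramOp hZ
  rw [projOfJ_stdJOp, cblock₁₁_stdProjOp, ← hu, Ring.inverse_unit]
  exact Units.isUnit _

/-- **`J ↦ Z(J)` is continuous on `X⁺(H₀)`** (blocks are continuous linear in `J`; `Ring.inverse` is continuous at
units of the Banach algebra `End(ℂᵖ)`). [cite: Deligne1982HodgeCycles, proof of Thm. 4.8, p. 49] [cite: GohbergLancasterRodman2005, §10.1] -/
theorem continuousOn_angularOp :
    ContinuousOn (angularOp : ((EuclideanSpace ℂ (Fin p) × EuclideanSpace ℂ (Fin q)) →L[ℂ]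
      (EuclideanSpace ℂ (Fin p) × EuclideanSpace ℂ (Fin q))) → _) (stdWeilDomain p q) := by
  intro J hJ
  obtain ⟨u, hu⟩ := isUnit_cblock₁₁_projOfJ hJ
  have h1 : ContinuousAt Ring.inverse (cblock₁₁ (projOfJ J)) := hu ▸ NormedRing.inverse_continuousAt u
  have h2 : ContinuousAt (fun J' : (EuclideanSpace ℂ (Fin p) × EuclideanSpace ℂ (Fin q)) →L[ℂ]
      (EuclideanSpace ℂ (Fin p) × EuclideanSpace ℂ (Fin q)) => Ring.inverse (cblock₁₁ (projOfJ J'))) J :=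
    ContinuousAt.comp (g := Ring.inverse) (f := fun J' => cblock₁₁ (projOfJ J')) h1
      (continuous_cblock₁₁.comp continuous_projOfJ).continuousAt
  exact ((continuous_cblock₂₁.comp continuous_projOfJ).continuousAt.clm_comp h2).continuousWithinAt

/-- `J_{Z(J)} = J` where `Z(J)` is the tree's bijection `stdWeilComplexStructureEquiv` (`J ↦ graph⁻¹(ker(J - i))`).
[cite: vanGeemen1994HodgeAV, 5.5–5.8] [cite: GohbergLancasterRodman2005, §10.1 Cor. 10.1.4] -/
theorem stdJOp_stdWeilComplexStructureEquiv
    {J : (EuclideanSpace ℂ (Fin p) × EuclideanSpace ℂ (Fin q)) →L[ℂ]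
      (EuclideanSpace ℂ (Fin p) × EuclideanSpace ℂ (Fin q))} (hJ : J ∈ stdWeilDomain p q) :
    stdJOp (stdWeilComplexStructureEquiv p q ⟨(J : _ →ₗ[ℂ] _), mem_stdWeilDomain_iff.1 hJ⟩).1 = J := by
  set Z := stdWeilComplexStructureEquiv p q ⟨(J : _ →ₗ[ℂ] _), mem_stdWeilDomain_iff.1 hJ⟩ with hZdef
  have hgraph : graphPlane Z.1 = Module.End.eigenspace
      ((J : _ →L[ℂ] _) : (EuclideanSpace ℂ (Fin p) × EuclideanSpace ℂ (Fin q)) →ₗ[ℂ]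
        (EuclideanSpace ℂ (Fin p) × EuclideanSpace ℂ (Fin q))) Complex.I :=
    graphPlane_stdWeilComplexStructureEquiv ⟨_, mem_stdWeilDomain_iff.1 hJ⟩
  have hW : IsPolarizingPlane (stdHermitianSesqForm p q) (graphPlane Z.1) :=
    isPolarizingPlane_std_iff.2 ((isPositivePlane_graphPlane_iff Z.1).2 Z.2)
  have h := isCompl_orthogonalBilin_of_isPosDefOn hW.1
  have h' := isCompl_orthogonalBilin_of_isPosDefOn (mem_stdWeilDomain_iff.1 hJ).isPolarizingPlane_eigenspace.1
  apply ContinuousLinearMap.coe_injective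
  rw [stdJOp_eq_complexStructureOfPlane Z.2 h, complexStructureOfPlane_congr hgraph h h',
    (mem_stdWeilDomain_iff.1 hJ).complexStructureOfPlane_eigenspace h']

/-- **The angular operator IS the tree's bijection `X⁺(H₀) ≃ I_{p,q}`** (`stdWeilComplexStructureEquiv`,
`J ↦` the `Z` with `graph Z = ker(J - i)`): the homeomorphism below upgrades that bijection.
[cite: GohbergLancasterRodman2005, §10.1 Cor. 10.1.4] [cite: vanGeemen1994HodgeAV, 5.8] -/
theorem angularOp_eq_stdWeilComplexStructureEquiv
    {J : (EuclideanSpace ℂ (Fin p) × EuclideanSpace ℂ (Fin q)) →L[ℂ]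
      (EuclideanSpace ℂ (Fin p) × EuclideanSpace ℂ (Fin q))} (hJ : J ∈ stdWeilDomain p q) :
    angularOp J = (stdWeilComplexStructureEquiv p q ⟨(J : _ →ₗ[ℂ] _), mem_stdWeilDomain_iff.1 hJ⟩).1 := by
  set Z := stdWeilComplexStructureEquiv p q ⟨(J : _ →ₗ[ℂ] _), mem_stdWeilDomain_iff.1 hJ⟩ with hZ
  have h1 : stdJOp Z.1 = J := stdJOp_stdWeilComplexStructureEquiv hJ
  have h2 : angularOp (stdJOp Z.1) = Z.1 := angularOp_stdJOp Z.2
  rwa [h1] at h2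

/-! ### The homeomorphism -/

variable (p q)

/-- **`I_{p,q} ≃ₜ X⁺(H₀)`: `Z ↦ J_Z` is a homeomorphism of the open unit ball onto the Weil domain of the standard
Hermitian space**, with inverse the angular operator `J ↦ P₂₁ P₁₁⁻¹`, `P = ½(1 - iJ)`.
[cite: Deligne1982HodgeCycles, proof of Thm. 4.8, p. 49 ("an open connected complex submanifold of a Grassmannian")]
[cite: CarlsonMullerStachPeters2017, Thm. 16.1.5 (type AIII, "realization as a bounded domain `I_{p,q}`")] -/
def unitaryPeriodDomainHomeomorph : unitaryPeriodDomain p q ≃ₜ stdWeilDomain p q where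
  toFun Z := ⟨stdJOp Z.1, stdJOp_mem_stdWeilDomain Z.2⟩
  invFun J := ⟨angularOp J.1, angularOp_mem_unitaryPeriodDomain J.2⟩
  left_inv Z := Subtype.ext (angularOp_stdJOp Z.2)
  right_inv J := Subtype.ext (stdJOp_angularOp J.2)
  continuous_toFun := continuousOn_iff_continuous_restrict.1 continuousOn_stdJOp |>.subtype_mk _
  continuous_invFun := continuousOn_iff_continuous_restrict.1 continuousOn_angularOp |>.subtype_mk _

variable {p q}

/-- On carriers: `(unitaryPeriodDomainHomeomorph Z).1 = J_Z`. [cite: vanGeemen1994HodgeAV, 5.5] -/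
@[simp] theorem coe_unitaryPeriodDomainHomeomorph_apply (Z : unitaryPeriodDomain p q) :
    (unitaryPeriodDomainHomeomorph p q Z).1 = stdJOp Z.1 := rfl

/-- … and back: `(unitaryPeriodDomainHomeomorph⁻¹ J).1 = Z(J)`. [cite: GohbergLancasterRodman2005, §10.1] -/
@[simp] theorem coe_unitaryPeriodDomainHomeomorph_symm_apply (J : stdWeilDomain p q) :
    ((unitaryPeriodDomainHomeomorph p q).symm J).1 = angularOp J.1 := rfl

variable (p q)

/-- **`X⁺(H₀)` is homeomorphic to the open unit ball of `Hom(ℂᵖ, ℂ^q)`** (a bounded domain in `ℂ^{pq}`).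
[cite: CarlsonMullerStachPeters2017, Thm. 16.1.5 (type AIII)] [cite: Deligne1982HodgeCycles, proof of Thm. 4.8, p. 49] -/
def stdWeilDomainHomeomorphBall :
    stdWeilDomain p q ≃ₜ Metric.ball (0 : EuclideanSpace ℂ (Fin p) →L[ℂ] EuclideanSpace ℂ (Fin q)) 1 :=
  (unitaryPeriodDomainHomeomorph p q).symm.trans (Homeomorph.setCongr (unitaryPeriodDomain_eq_ball p q))

/-- **`X⁺(H₀)` is contractible** (homeomorphic to a convex open ball). [cite: Deligne1982HodgeCycles, proof of Thm. 4.8, p. 49] -/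
theorem contractibleSpace_stdWeilDomain : ContractibleSpace (stdWeilDomain p q) := by
  haveI : ContractibleSpace (Metric.ball (0 : EuclideanSpace ℂ (Fin p) →L[ℂ] EuclideanSpace ℂ (Fin q)) 1) :=
    (convex_ball _ _).contractibleSpace ⟨0, Metric.mem_ball_self one_pos⟩
  exact (stdWeilDomainHomeomorphBall p q).contractibleSpace

end Literature.AlgebraicGeometry.Motives
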